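import Literature.Barriers.RiemannHypothesis.TuranPartialSumsBohr
import HarnessLib

/-!
# Bohr's equivalence for WEIGHTED sections `∑_{n ≤ N} a(n) n^{−s}` (Cesàro means, alternating sections)

Barrier catalogue `Literature/Barriers/RiemannHypothesis/`, companion of `TuranPartialSums.lean` and of
`TuranPartialSumsBohr.lean` (proofs only: no definitions, no named facts). The Bohr–Kronecker–Hurwitz
transfer of `TuranPartialSumsBohr.lean` is proved there for the plain sections
`ζ_N(s) = ∑_{n ≤ N} n^{−s}`; Turán's Theorems VII–VIII (1948, §§5–6) concern instead the Cesàro means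
`C_n(s) = ∑_{ν ≤ n} (1 − ν/(n+1)) ν^{−s}` and the alternating sections `V_n(s) = ∑_{m ≤ n} (−1)^{m+1} m^{−s}`
("We can prove all the corresponding theorems on replacing `U_n(s)` with the Cesàro-means", §5;
"the analogues of theorems II, III, IV and V are true", §6), i.e. Dirichlet polynomials
`P_a(s) = ∑_{n ≤ N} a(n) n^{−s}` with general (non-multiplicative) weights `a`. Bohr's step is
insensitive to the weights: for a completely multiplicative `ψ`, unimodular at the primes, Kronecker's
theorem moves the prime phases `p^{it}` near `ψ(p)` simultaneously, so the vertical shifts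
`P_a(· − it)` approximate the twisted polynomial `P_{aψ}(s) = ∑ a(n) ψ(n) n^{−s}` uniformly on discs,
and Hurwitz's theorem transfers zeros of `P_{aψ}` to zeros of `P_a` with nearby real part. This file
machine-checks that generalisation; it is used by `TuranPartialSumsCesaroAltProofs.lean` (Turán's
Theorems VII–VIII along Turán's own route).

All sums are written with the tree's `twistedPartialSum a N s = ∑_{n=1}^{N} a(n) n^{−s}` (its first
argument is an arbitrary coefficient sequence) and `realTwistedSum c N σ = ∑_{n=1}^{N} c(n) n^{−σ}`.

## Main results (sorry-free)

* `WeightedBohr.exists_zero_near_twist_zero` (**Bohr transfer for weighted sections, localized**): if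
  `P_{aψ}` is not identically zero and vanishes at `s₀`, then for every `r > 0` and every `T` the
  polynomial `P_a` has a zero `s` with `|Re s − Re s₀| < r`, `|Im s| ≥ T`.
* `WeightedBohr.realTwistedSum_weighted_nonneg` (**Turán's step for weighted sections**): for real
  weights `a` with `a(1) > 0` and a completely multiplicative real twist `χ`, `χ(p) = ±1`: if every zero
  of `P_a` has `Re s ≤ σ₁`, then `∑_{n ≤ N} a(n) χ(n) n^{−σ₁} ≥ 0` (sign at `+∞`, intermediate value
  theorem, transfer) — the form in which Turán uses Bohr's theorem ("so implies `W_n(σ) ≥ 0`",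
  Ingham's review MR 10,286b), now for `C_n`, `V_n`.

## References

* [Turan1948] P. Turán, *On some approximative Dirichlet-polynomials in the theory of the
  zeta-function of Riemann*, Danske Vid. Selsk. Mat.-Fys. Medd. 24 (1948), no. 17, §§5–6 (Theorems
  VII–VIII; read, pp. 8–9).
* [Apostol1990] T. M. Apostol, *Modular Functions and Dirichlet Series in Number Theory*, 2nd ed.,
  §8.11 Thm. 8.16 (Bohr's equivalence theorem), §8.13 proof of Thm. 8.20.
* [Montgomery1983] H. L. Montgomery, *Zeros of approximations to the zeta function*, Studies in Pure
  Mathematics (Turán memorial volume), Birkhäuser 1983, §1 (p. 498: `C_N`, `V_N`), §2 (read).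
* [Titchmarsh1986] E. C. Titchmarsh, *The Theory of the Riemann Zeta-Function*, 2nd ed., §10.25.
-/

noncomputable section

open Complex Filter Metric Set Topology

namespace Literature.Barriers.RiemannHypothesis

namespace WeightedBohr

/-! ## The comparison `P_a(s − it) − P_{aψ}(s)` -/

/-- `P_a(s − it) − P_{aψ}(s) = ∑_{n ≤ N} a(n) (n^{it} − ψ(n)) n^{−s}`. [cite: Montgomery1983, §2] -/
theorem twistedPartialSum_shift_sub_twisted (a ψ : ℕ → ℂ) (N : ℕ) (s : ℂ) (t : ℝ) :
    twistedPartialSum a N (s - t * I) - twistedPartialSum (fun n ↦ a n * ψ n) N s =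
      ∑ n ∈ Finset.Icc 1 N, a n * ((n : ℂ) ^ ((t : ℂ) * I) - ψ n) * (n : ℂ) ^ (-s) := by
  rw [twistedPartialSum, twistedPartialSum, ← Finset.sum_sub_distrib]
  refine Finset.sum_congr rfl fun n hn ↦ ?_
  rw [Finset.mem_Icc] at hn
  have hn0 : (n : ℂ) ≠ 0 := by exact_mod_cast (show n ≠ 0 by omega)
  rw [show -(s - t * I) = (t : ℂ) * I + -s by ring, cpow_add _ _ hn0]
  ring

/-- A Dirichlet polynomial that is not identically zero is zero-free on arbitrarily small circles
about any point (isolated zeros of a non-trivial entire function). [folklore] -/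
theorem exists_sphere_ne_zero {F : ℂ → ℂ} (hF : Differentiable ℂ F) (hnz : ∃ z, F z ≠ 0) (s₀ : ℂ)
    {r : ℝ} (hr : 0 < r) :
    ∃ r' : ℝ, 0 < r' ∧ r' ≤ r ∧ ∀ z ∈ sphere s₀ r', F z ≠ 0 := by
  have han : AnalyticOnNhd ℂ F univ := fun z _ ↦ hF.analyticAt z
  rcases (han s₀ (mem_univ _)).eventually_eq_zero_or_eventually_ne_zero with h | h
  · exfalso
    obtain ⟨z, hz⟩ := hnz
    have h0 := han.eqOn_zero_of_preconnected_of_eventuallyEq_zero isPreconnected_univ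
      (mem_univ s₀) h
    exact hz (h0 (mem_univ z))
  · obtain ⟨r₀, hr₀, hball⟩ := Metric.eventually_nhds_iff_ball.1 (eventually_nhdsWithin_iff.1 h)
    refine ⟨min (r₀ / 2) r, lt_min (by positivity) hr, min_le_right _ _, fun z hz ↦ ?_⟩
    have hzr : dist z s₀ = min (r₀ / 2) r := mem_sphere.1 hz
    refine hball z (mem_ball.2 (hzr.trans_lt ((min_le_left _ _).trans_lt (by linarith)))) ?_
    intro hz0
    rw [mem_singleton_iff] at hz0
    rw [hz0, dist_self] at hzr
    exact (lt_min (by positivity) hr : (0 : ℝ) < min (r₀ / 2) r).ne hzr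

/-! ## Completely multiplicative unimodular twists of a weighted section -/

section Twist

variable {ψ : ℕ → ℂ} (hmul : ∀ m n : ℕ, m ≠ 0 → n ≠ 0 → ψ (m * n) = ψ m * ψ n)
  (hψ : ∀ p : ℕ, p.Prime → ‖ψ p‖ = 1)
include hmul hψ

/-- The uniform estimate: if `|p^{it} − ψ(p)| ≤ η` for the primes `p ≤ N`, then
`|P_a(s − it) − P_{aψ}(s)| ≤ η ∑_{n ≤ N} |a(n)| n · n^{−Re s}` (prime-by-prime bookkeeping,
`norm_cpow_sub_twist_le`). [cite: Titchmarsh1986, §10.25] -/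
theorem norm_shift_sub_twisted_le (a : ℕ → ℂ) {N : ℕ} {t η : ℝ} (hη : 0 ≤ η)
    (h : ∀ p : ℕ, p.Prime → p ≤ N → ‖(p : ℂ) ^ ((t : ℂ) * I) - ψ p‖ ≤ η) (s : ℂ) :
    ‖twistedPartialSum a N (s - t * I) - twistedPartialSum (fun n ↦ a n * ψ n) N s‖ ≤
      η * ∑ n ∈ Finset.Icc 1 N, ‖a n‖ * ((n : ℝ) * (n : ℝ) ^ (-s.re)) := by
  rw [twistedPartialSum_shift_sub_twisted, Finset.mul_sum]
  refine (norm_sum_le _ _).trans (Finset.sum_le_sum fun n hn ↦ ?_)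
  rw [Finset.mem_Icc] at hn
  have hn0 : n ≠ 0 := by omega
  rw [norm_mul, norm_mul, norm_natCast_cpow_of_pos (Nat.pos_of_ne_zero hn0), neg_re]
  have h1 := norm_cpow_sub_twist_le hmul hψ hη h n hn0 hn.2
  have h2 : 0 ≤ (n : ℝ) ^ (-s.re) := Real.rpow_nonneg (Nat.cast_nonneg n) _
  calc ‖a n‖ * ‖(n : ℂ) ^ ((t : ℂ) * I) - ψ n‖ * (n : ℝ) ^ (-s.re)
      ≤ ‖a n‖ * (n * η) * (n : ℝ) ^ (-s.re) := by gcongr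
    _ = η * (‖a n‖ * ((n : ℝ) * (n : ℝ) ^ (-s.re))) := by ring

/-- **Uniform approximation on a disc**: for every closed disc `|s − s₀| ≤ r` and `ε > 0` there is
`η > 0` such that `|p^{it} − ψ(p)| < η` for the primes `p ≤ N` forces `|P_a(s − it) − P_{aψ}(s)| ≤ ε`
on the disc. [cite: Titchmarsh1986, §10.25] -/
theorem exists_forall_norm_shift_sub_twisted_le (a : ℕ → ℂ) (N : ℕ) (s₀ : ℂ) (r : ℝ) {ε : ℝ}
    (hε : 0 < ε) :
    ∃ η : ℝ, 0 < η ∧ ∀ t : ℝ,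
      (∀ p : ℕ, p.Prime → p ≤ N → ‖(p : ℂ) ^ ((t : ℂ) * I) - ψ p‖ < η) →
        ∀ s ∈ closedBall s₀ r,
          ‖twistedPartialSum a N (s - t * I) - twistedPartialSum (fun n ↦ a n * ψ n) N s‖ ≤ ε := by
  -- the majorant constant on the disc
  set K : ℝ := ∑ n ∈ Finset.Icc 1 N, ‖a n‖ * ((n : ℝ) * (n : ℝ) ^ (-(s₀.re - r))) with hK
  have hK0 : 0 ≤ K := Finset.sum_nonneg fun n _ ↦ mul_nonneg (norm_nonneg _)
    (mul_nonneg (Nat.cast_nonneg n) (Real.rpow_nonneg (Nat.cast_nonneg n) _))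
  have hK1 : 0 < K + 1 := by linarith
  refine ⟨ε / (K + 1), div_pos hε hK1, fun t ht s hs ↦ ?_⟩
  have hη0 : 0 ≤ ε / (K + 1) := (div_pos hε hK1).le
  have hsre : s₀.re - r ≤ s.re := by
    have h1 : |(s - s₀).re| ≤ ‖s - s₀‖ := abs_re_le_norm _
    rw [mem_closedBall, dist_eq_norm] at hs
    rw [sub_re] at h1
    linarith [(abs_le.1 (h1.trans hs)).1]
  have hle := norm_shift_sub_twisted_le hmul hψ a hη0 (fun p hp hpN ↦ (ht p hp hpN).le) s
  refine hle.trans ?_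
  have hsum : ∑ n ∈ Finset.Icc 1 N, ‖a n‖ * ((n : ℝ) * (n : ℝ) ^ (-s.re)) ≤ K := by
    refine Finset.sum_le_sum fun n hn ↦ ?_
    rw [Finset.mem_Icc] at hn
    have hn1 : (1 : ℝ) ≤ n := by exact_mod_cast hn.1
    refine mul_le_mul_of_nonneg_left ?_ (norm_nonneg _)
    exact mul_le_mul_of_nonneg_left
      (Real.rpow_le_rpow_of_exponent_le hn1 (by linarith)) (Nat.cast_nonneg n)
  calc ε / (K + 1) * ∑ n ∈ Finset.Icc 1 N, ‖a n‖ * ((n : ℝ) * (n : ℝ) ^ (-s.re))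
      ≤ ε / (K + 1) * K := mul_le_mul_of_nonneg_left hsum hη0
    _ ≤ ε / (K + 1) * (K + 1) := mul_le_mul_of_nonneg_left (by linarith) hη0
    _ = ε := div_mul_cancel₀ ε hK1.ne'

open Literature.NumberTheory.DiophantineApproximation in
/-- For every `k` there is a real `t` with `|t| ≥ k` such that `P_a(· − it)` is within `1/(k+1)` of
`P_{aψ}` on the closed disc `|s − s₀| ≤ r` (Kronecker's theorem for the phases `p^{it}`, `p ≤ N`, with
targets `ψ(p)`). [cite: Titchmarsh1986, §10.25] -/
theorem exists_shift_close_twisted (a : ℕ → ℂ) (N : ℕ) (s₀ : ℂ) (r : ℝ) (k : ℕ) :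
    ∃ t : ℝ, (k : ℝ) ≤ |t| ∧ ∀ s ∈ closedBall s₀ r,
      ‖twistedPartialSum a N (s - t * I) - twistedPartialSum (fun n ↦ a n * ψ n) N s‖ ≤
        1 / (k + 1) := by
  obtain ⟨η, hη, hclose⟩ := exists_forall_norm_shift_sub_twisted_le hmul hψ a N s₀ r
    (ε := 1 / (k + 1)) (by positivity)
  obtain ⟨t, htk, ht⟩ := Kronecker.exists_abs_ge_forall_prime_norm_cpow_sub_lt N ψ hψ hη k
  exact ⟨t, htk, hclose t ht⟩

/-- **Bohr transfer for weighted sections, localized** (Apostol 1990, Thm. 8.16, for the equivalent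
Dirichlet polynomials `P_a = ∑ a(n) n^{−s}` and `P_{aψ} = ∑ a(n) ψ(n) n^{−s}`, the value `0`, with
two-sided localization of the real part). If `P_{aψ}` is not identically zero and vanishes at `s₀`,
then for every `r > 0` and every `T` the polynomial `P_a` has a zero `s` with `|Re s − Re s₀| < r` and
`|Im s| ≥ T`. Proof: `P_{aψ} ≠ 0` on a small circle `|s − s₀| = r' ≤ r`; by Kronecker, shifts `t_k`
(`|t_k| ≥ k`) make `P_a(· − i t_k) → P_{aψ}` uniformly on the disc; by Hurwitz, `P_a(· − i t_k)`
vanishes in the disc for all large `k`. [cite: Apostol1990, §8.11 Thm. 8.16]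
[cite: Montgomery1983, §2] -/
theorem exists_zero_near_twist_zero {a : ℕ → ℂ} {N : ℕ}
    (hnz : ∃ z, twistedPartialSum (fun n ↦ a n * ψ n) N z ≠ 0) {s₀ : ℂ}
    (h0 : twistedPartialSum (fun n ↦ a n * ψ n) N s₀ = 0) {r : ℝ} (hr : 0 < r) (T : ℝ) :
    ∃ s : ℂ, twistedPartialSum a N s = 0 ∧ |s.re - s₀.re| < r ∧ T ≤ |s.im| := by
  -- a zero-free circle around `s₀`
  obtain ⟨r', hr', hr'r, hsphere⟩ :=
    exists_sphere_ne_zero (differentiable_twistedPartialSum _ N) hnz s₀ hr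
  -- the shifts `t k`, `|t k| ≥ k`
  choose t htk ht using exists_shift_close_twisted hmul hψ a N s₀ r'
  set F : ℕ → ℂ → ℂ := fun k s ↦ twistedPartialSum a N (s - t k * I) with hF
  have hunif : TendstoUniformlyOn F (twistedPartialSum (fun n ↦ a n * ψ n) N) atTop
      (closedBall s₀ r') := by
    rw [Metric.tendstoUniformlyOn_iff]
    intro ε hε
    obtain ⟨k₀, hk₀⟩ := exists_nat_one_div_lt hε
    filter_upwards [eventually_ge_atTop k₀] with k hk s hs
    rw [dist_comm, dist_eq_norm]
    refine (ht k s hs).trans_lt (lt_of_le_of_lt ?_ hk₀)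
    have hk' : (k₀ : ℝ) ≤ k := by exact_mod_cast hk
    gcongr
  have hFdiff : ∀ᶠ k in atTop, DiffContOnCl ℂ (F k) (ball s₀ r') :=
    Eventually.of_forall fun k ↦
      ((differentiable_twistedPartialSum a N).comp (differentiable_id.sub_const _)).diffContOnCl
  have hcont : ContinuousOn (twistedPartialSum (fun n ↦ a n * ψ n) N) (sphere s₀ r') :=
    (differentiable_twistedPartialSum _ N).continuous.continuousOn
  have hev := Complex.eventually_exists_zero_mem_ball_of_tendstoUniformlyOn hr' hFdiff hunif hcont
    h0 hsphere
  -- a large index `k`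
  obtain ⟨k, ⟨z, hz, hz0⟩, hk⟩ := (hev.and (eventually_ge_atTop ⌈T + |s₀.im| + r'⌉₊)).exists
  have hzr : ‖z - s₀‖ < r' := by rwa [mem_ball, dist_eq_norm] at hz
  refine ⟨z - t k * I, hz0, ?_, ?_⟩
  · have h1 : |(z - s₀).re| ≤ ‖z - s₀‖ := abs_re_le_norm _
    rw [sub_re] at h1
    have : (z - t k * I).re = z.re := by simp
    rw [this]
    exact lt_of_le_of_lt h1 (hzr.trans_le hr'r)
  · have him : |z.im - s₀.im| < r' := by
      have h1 : |(z - s₀).im| ≤ ‖z - s₀‖ := abs_im_le_norm _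
      rw [sub_im] at h1
      exact h1.trans_lt hzr
    have hk' : T + |s₀.im| + r' ≤ k := (Nat.le_ceil _).trans (by exact_mod_cast hk)
    have himw : (z - t k * I).im = z.im - t k := by simp
    rw [himw]
    have h2 : |t k| ≤ |z.im - t k| + |z.im| := by
      have := abs_sub_abs_le_abs_sub (t k) z.im
      rw [abs_sub_comm] at this
      linarith
    have h3 : |z.im| ≤ |z.im - s₀.im| + |s₀.im| := by
      have := abs_add_le (z.im - s₀.im) s₀.im
      rwa [sub_add_cancel] at this
    linarith [htk k]

/-- Half-plane form for the value `0`: if `P_{aψ}` (not identically zero) vanishes at `s₀` with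
`Re s₀ > c`, then `P_a` vanishes somewhere in the half-plane `σ > c`, at points of arbitrarily large
height. [cite: Apostol1990, §8.11 Thm. 8.16] -/
theorem exists_zero_of_twist_zero {a : ℕ → ℂ} {N : ℕ}
    (hnz : ∃ z, twistedPartialSum (fun n ↦ a n * ψ n) N z ≠ 0) {s₀ : ℂ}
    (h0 : twistedPartialSum (fun n ↦ a n * ψ n) N s₀ = 0) {c : ℝ} (hc : c < s₀.re) (T : ℝ) :
    ∃ s : ℂ, twistedPartialSum a N s = 0 ∧ c < s.re ∧ T ≤ |s.im| := by
  obtain ⟨s, hs0, hsre, hsim⟩ :=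
    exists_zero_near_twist_zero hmul hψ hnz h0 (r := s₀.re - c) (by linarith) T
  refine ⟨s, hs0, ?_, hsim⟩
  have := (abs_lt.1 hsre).1
  linarith

end Twist

/-! ## Real weights and real (`±1`-valued) twists: the sign at `+∞` and Turán's step -/

section RealWeights

/-- As `σ → +∞` a real Dirichlet polynomial `∑_{n ≤ N} c(n) n^{−σ}` (`N ≥ 1`) tends to its leading
coefficient `c(1)` (every other term is `c(n) n^{−σ} → 0`). [folklore] -/
theorem tendsto_realTwistedSum_atTop (c : ℕ → ℝ) {N : ℕ} (hN : 1 ≤ N) :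
    Tendsto (realTwistedSum c N) atTop (𝓝 (c 1)) := by
  have hsplit : ∀ σ : ℝ, realTwistedSum c N σ =
      c 1 + ∑ n ∈ Finset.Icc 2 N, c n * (n : ℝ) ^ (-σ) := by
    intro σ
    rw [realTwistedSum, Finset.Icc_eq_cons_Ioc hN, Finset.sum_cons,
      show Finset.Icc 2 N = Finset.Ioc 1 N from Finset.Icc_add_one_left_eq_Ioc 1 N]
    simp
  have hfun : realTwistedSum c N = fun σ ↦ c 1 + ∑ n ∈ Finset.Icc 2 N, c n * (n : ℝ) ^ (-σ) :=
    funext hsplit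
  rw [hfun]
  have hlim : Tendsto (fun σ : ℝ ↦ ∑ n ∈ Finset.Icc 2 N, c n * (n : ℝ) ^ (-σ)) atTop (𝓝 0) := by
    have h0 : (0 : ℝ) = ∑ n ∈ Finset.Icc 2 N, c n * 0 := by simp
    rw [h0]
    refine tendsto_finsetSum _ fun n hn ↦ ?_
    rw [Finset.mem_Icc] at hn
    have hn1 : (1 : ℝ) < n := by exact_mod_cast (show 1 < n by omega)
    have hb := (tendsto_rpow_atBot_of_base_gt_one (n : ℝ) hn1).comp tendsto_neg_atTop_atBot
    exact hb.const_mul (c n)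
  simpa using hlim.const_add (c 1)

/-- Hence, if `c(1) > 0`, the polynomial `∑_{n ≤ N} c(n) n^{−σ}` is positive for all large real `σ`.
[folklore] -/
theorem exists_forall_realTwistedSum_pos {c : ℕ → ℝ} {N : ℕ} (hN : 1 ≤ N) (hc : 0 < c 1) :
    ∃ σ₀ : ℝ, ∀ σ : ℝ, σ₀ ≤ σ → 0 < realTwistedSum c N σ := by
  have hev : ∀ᶠ σ in atTop, 0 < realTwistedSum c N σ :=
    (tendsto_realTwistedSum_atTop c hN).eventually (lt_mem_nhds hc)
  obtain ⟨σ₀, hσ₀⟩ := eventually_atTop.1 hev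
  exact ⟨σ₀, hσ₀⟩

variable {χ : ℕ → ℝ} (hmul : ∀ m n : ℕ, m ≠ 0 → n ≠ 0 → χ (m * n) = χ m * χ n)
  (hχ : ∀ p : ℕ, p.Prime → |χ p| = 1)
include hmul hχ

/-- A completely multiplicative real `χ` with `χ(p) = ±1` has `χ(1) = 1`. [folklore] -/
theorem realTwist_apply_one : χ 1 = 1 := by
  have h := twist_apply_one (realTwist_complex_mul hmul) (realTwist_complex_norm hχ)
  exact_mod_cast h

omit hmul hχ in
/-- The complexified weighted twist `n ↦ a(n) χ(n)` as a product of complex sequences. [folklore] -/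
theorem ofReal_weight_mul_twist (a : ℕ → ℝ) :
    (fun n : ℕ ↦ (((a n * χ n : ℝ)) : ℂ)) = fun n : ℕ ↦ ((a n : ℝ) : ℂ) * ((χ n : ℝ) : ℂ) := by
  funext n
  push_cast
  ring

/-- **Turán's step through Bohr's theorem, for weighted sections.** Let `a` be real weights with
`a(1) > 0`, `χ` completely multiplicative with `χ(p) = ±1`, `N ≥ 1`. If every zero of
`P_a(s) = ∑_{n ≤ N} a(n) n^{−s}` has `Re s ≤ σ₁`, then `∑_{n ≤ N} a(n) χ(n) n^{−σ₁} ≥ 0`. Proof: the real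
twisted polynomial is continuous, positive for large `σ` (its leading coefficient is
`a(1)χ(1) = a(1) > 0`); were it negative at `σ₁` it would vanish at some `σ* > σ₁` (intermediate value
theorem), and the Bohr transfer at `s₀ = σ*`, `r = σ* − σ₁` would produce a zero of `P_a` with
`Re s > σ₁`. This is Turán's "by a theorem of Bohr … implies `W_n(σ) ≥ 0`" (Ingham, MR 10,286b) for the
Cesàro and alternating sections of his §§5–6. [cite: Turan1948, §§5–6 (Theorems VII–VIII)]
[cite: Apostol1990, §8.13, proof of Thm. 8.20] -/
theorem realTwistedSum_weighted_nonneg {a : ℕ → ℝ} (ha : 0 < a 1) {N : ℕ} (hN : 1 ≤ N) {σ₁ : ℝ}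
    (h : ∀ s : ℂ, twistedPartialSum (fun n ↦ ((a n : ℝ) : ℂ)) N s = 0 → s.re ≤ σ₁) :
    0 ≤ realTwistedSum (fun n ↦ a n * χ n) N σ₁ := by
  by_contra hneg
  push Not at hneg
  -- positivity far to the right
  have hc1 : 0 < a 1 * χ 1 := by
    rw [realTwist_apply_one hmul hχ, mul_one]
    exact ha
  obtain ⟨σ₀, hσ₀⟩ := exists_forall_realTwistedSum_pos (c := fun n ↦ a n * χ n) hN hc1
  set b : ℝ := max σ₁ σ₀ with hb
  have hpos : 0 < realTwistedSum (fun n ↦ a n * χ n) N b := hσ₀ b (le_max_right _ _)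
  have hab : σ₁ ≤ b := le_max_left _ _
  -- a real zero `σ* > σ₁` of the twisted polynomial
  have hivt := intermediate_value_Icc hab
    (continuous_realTwistedSum (fun n ↦ a n * χ n) N).continuousOn
  obtain ⟨σs, hσs, hzero⟩ := hivt ⟨hneg.le, hpos.le⟩
  have hσs1 : σ₁ < σs := by
    rcases eq_or_lt_of_le hσs.1 with h' | h'
    · exfalso; rw [← h'] at hzero; linarith
    · exact h'
  -- the complexified twisted polynomial vanishes at `σ*` and not at `b`
  have h0 : twistedPartialSum (fun n ↦ ((a n : ℝ) : ℂ) * ((χ n : ℝ) : ℂ)) N (σs : ℂ) = 0 := by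
    rw [← ofReal_weight_mul_twist a, twistedPartialSum_ofReal, hzero, ofReal_zero]
  have hnz : ∃ z, twistedPartialSum (fun n ↦ ((a n : ℝ) : ℂ) * ((χ n : ℝ) : ℂ)) N z ≠ 0 := by
    refine ⟨(b : ℂ), ?_⟩
    rw [← ofReal_weight_mul_twist a, twistedPartialSum_ofReal]
    exact_mod_cast hpos.ne'
  obtain ⟨s, hs0, hsre, -⟩ := exists_zero_near_twist_zero (a := fun n ↦ ((a n : ℝ) : ℂ))
    (realTwist_complex_mul hmul) (realTwist_complex_norm hχ) hnz h0 (r := σs - σ₁) (by linarith) 0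
  have := (abs_lt.1 hsre).1
  simp only [ofReal_re] at this
  have := h s hs0
  linarith

/-- The same conclusion from the usual "zero-free closed half-plane" hypothesis: if `P_a(s) ≠ 0`
whenever `Re s ≥ σ₁`, then `∑_{n ≤ N} a(n) χ(n) n^{−σ₁} ≥ 0`. [cite: Turan1948, §§5–6] -/
theorem realTwistedSum_weighted_nonneg_of_zeroFree {a : ℕ → ℝ} (ha : 0 < a 1) {N : ℕ} (hN : 1 ≤ N)
    {σ₁ : ℝ} (h : ∀ s : ℂ, σ₁ ≤ s.re → twistedPartialSum (fun n ↦ ((a n : ℝ) : ℂ)) N s ≠ 0) :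
    0 ≤ realTwistedSum (fun n ↦ a n * χ n) N σ₁ := by
  refine realTwistedSum_weighted_nonneg hmul hχ ha hN fun s hs ↦ ?_
  by_contra hlt
  push Not at hlt
  exact h s hlt.le hs

end RealWeights

end WeightedBohr

end Literature.Barriers.RiemannHypothesis

end
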